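import Literature.MathematicalPhysics.QuantumFieldTheory.BalabanImbrieJaffe1984to88.BIJ88RemovedFieldBounds286

/-!
# `BalabanImbrieJaffe1984to88.BIJ88RegularityJ286` — T. Bałaban, J. Imbrie, A. Jaffe, *Effective action and cluster properties of the abelian
Higgs model*, Commun. Math. Phys. **114** (1988) 257–315 [BalabanImbrieJaffe1988], the LAST sentence of the p. 286 [PDF 30] verification of the
regularity of the new background field `ũ_{k+1}`, verbatim: *"In an analogous fashion we can check that the j-th regularity condition for
r(e_k)-cubes remains valid."* — the `j`-th condition being (4.3) p. 274 [PDF 18]: *"for each j < k (and lattice spacing ζ = L^{−j}), and for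
each r(e_j)-cube □ in Λ̄₁^{(j)}, there exists a gauge transformation u_k → u_k^λ such that u^λ_{k,b} = exp(ie_jL^{−j}A^λ_b) with |A^λ_b|,
|(∂^ζA^λ)(p)|, |(∂^{ζ*}A^λ)(x)| ≦ cp(e_j)r(e_j) (4.3) in □"* (r18's `BIJ88Sect4Statements.Smooth43 e_j ζ`, r16's cube-family form
`BIJ88Regularity286.Regular286`).  PROVED as the *"analogous fashion"*: the mechanism of the `k`-th check (p36's `BIJ88Smooth43Phase`:
multiplying a (4.3)-smooth field by the phase of a bounded field keeps (4.3), constant `c + c′`) READ IN THE UNITS `(e_j, ζ)` of the `j`-th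
condition — every operation of Sect. 5 multiplies the background field by a phase `exp(±ie_kη g)` with `g`, `∂^ηg`, `∂^{η*}g` bounded (this
seat's gen-8/9 `BIJ88Regularity561`, `BIJ88RemovedFieldBounds286`), and `e_kη g = e_jζ·(ρg)` with `ρ = e_kη/(e_jζ)`, `∂^ζ = (η/ζ)∂^η`,
`∂^{ζ*} = (η/ζ)∂^{η*}`, so the same gauge function and the potential `A^λ ± ρg` witness the `j`-th condition for the new field with constant
`c + c′` as soon as `|ρ|G₀, |ρ||η/ζ|G₁, |ρ||η/ζ|G₂ ≦ c′p(e_j)r(e_j)` (in print `ρ = L^{(k−j)(2−d)/2} ≦ 1`, `η/ζ = L^{−(k−j)} ≦ 1` by (2.2), and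
`p(e_k)r(e_k) ≦ p(e_j)r(e_j)`: *"remains valid"*).

statement-level skeleton of published theorems with citation tags; proofs where landed; nothing here is a claim about the Yang–Mills mass gap

PDF held: `paper:balaban1988-cmp114-bij-abelian-higgs-effective-action` (journal page = PDF page + 256); p. 286 [PDF 30] read as an image this
session (seat folder `pages/original-p030-x2.png`); (4.3) p. 274 as quoted in r18's `BIJ88Sect4Statements`.

CITATION HEADER (lean-in-tree rule).  Part of the lit-balaban TYPED SKELETON (HOME `run/shared/lean/pub/lit-balaban/`), PHASE-2 proof seat p31
gen 9 (unit `lit-balaban-p31-g9`; third file of the gen; TAKING line HOME/STATUS.md).  WHAT IS REPRODUCED: row `C2.Claim@286` (owner r16,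
`HOME/lit-balaban-r16/ROWS-C2-part2.md`), its last sentence, which this seat's gen-8 `BIJ88Regularity561` and gen-9 `BIJ88RemovedFieldBounds286`
declared *not treated*.

WHAT IS PROVED (0 `sorry`, standard axioms; theorems only).
* §1 change of the lattice-spacing parameter: `curl_units`/`diverg_units` (`∂^{c′}(a·g) = a(c′/c)∂^c g`), `exp_units` (`e^{ie′ηg} = e^{ieζ(ρg)}`,
  `ρ = e′η/(eζ)`).
* §2 **`smooth43_mul_exp_units`** / `smooth43_mul_exp_neg_units`: `Smooth43 e ζ c p r X B Pl u`, a field `g` with `|g| ≦ G₀` on `B`, `|∂^ηg| ≦ G₁`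
  on `Pl`, `|∂^{η*}g| ≦ G₂` on `X` and the side conditions `|ρ|G₀, |ρ(η/ζ)|G₁, |ρ(η/ζ)|G₂ ≦ c′pr` ⟹ `Smooth43 e ζ (c + c′) p r X B Pl (u·e^{±ie′ηg})`
  (p36's `smooth43_mul_exp(_neg)` after the conversion); cube-family forms `regular286_mul_exp_units`/`regular286_mul_exp_neg_units`.
* §3 **`regular286J_uTilde561`**: the `j`-th condition for `ũ_{k+1}` of (5.6.1) from the `j`-th condition for the (5.5.14) field `u′_k` and the
  η-unit bounds on the removed field `g = θ_kH_{k,loc}A^{(k)} + w₁A′` ((5.6.6) inverted, gen-8 `uTilde561_eq_mul_exp_neg`);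
  **`regular286J_uTilde561_of_fieldBounds`**: the same with the three bounds supplied by gen-9 `removedField_bounds` (discrete Leibniz + field-level
  bounds on `H_{k,loc}A^{(k)}`, `w₁A′`).
HONEST SCOPE.  The sentence's *"analogous fashion"* made explicit for the LAST operation of the chain (removal of `θ_kH_{k,loc}A^{(k)} + w₁A′`,
the one this seat's files treat at level `k`); the earlier operations (translations (5.3.3)/(5.5.13), the gauge transformation) are covered by
the same §2 lemmas and r16's `regular286_gaugeU_iff` verbatim.  The `j`-th condition for `u_k` itself is the induction hypothesis (4.3) (input);
the size relations `ρ ≦ 1`, `η/ζ ≦ 1`, `p(e_k)r(e_k) ≦ p(e_j)r(e_j)` of the printed parametrization (2.2) are not needed in this form (the side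
conditions are displayed) and not derived here.  Imports: this seat's `BIJ88RemovedFieldBounds286` (p303966).  Unit `lit-balaban-p31`
(literature-prover-lit-balaban-p31-g9-0), 2026-08-21.  NOT summit progress.
-/

namespace Literature.MathematicalPhysics.QuantumFieldTheory.BalabanImbrieJaffe1984to88.BIJ88RegularityJ286

open Literature.MathematicalPhysics.QuantumFieldTheory.Balaban1983to89
open BIJ88Sect3Statements (starB starP)
open BIJ88Sect4Statements (Smooth43)
open BIJ88Regularity286 (Regular286 cubeSites regular286_of_eqOn)
open BIJ88Sect5StatementsPart3 (bgExp uTilde561)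
open BIJ88Smooth43Phase (smooth43_mul_exp smooth43_mul_exp_neg)
open BIJ88Regularity561 (uTilde561_eq_mul_exp_neg)
open BIJ88RemovedFieldBounds286 (removedField_bounds)
open LatticeFieldCalculus (curl diverg supDist)
open Complex

noncomputable section

variable {P : Params} {n : ℕ}

/-! ## §1  Changing the lattice-spacing parameter: `∂^ζ = (η/ζ)∂^η`, `e_kη g = e_jζ·(ρg)` -/

/-- kernel: **`∂^{c′}(a·g) = a·(c′/c)·∂^c g`** — the plaquette variable with another spacing parameter (and a constant factor), `c ≠ 0`; in print
`∂^ζ = (ζ⁻¹/η⁻¹)∂^η = (η/ζ)∂^η`. [cite: BalabanImbrieJaffe1988, (4.3) p.286] -/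
theorem curl_units {c : ℝ} (hc : c ≠ 0) (c' a : ℝ) (g : PBond P n → ℝ) (p : Balaban1983to89.Plaq P n) :
    curl c' (fun b => a * g b) p = a * (c' / c) * curl c g p := by
  simp only [curl, smul_eq_mul]
  field_simp

/-- kernel: **`∂^{c′*}(a·g) = a·(c′/c)·∂^{c*} g`** (divergence, `c ≠ 0`). [cite: BalabanImbrieJaffe1988, (4.3) p.286] -/
theorem diverg_units {c : ℝ} (hc : c ≠ 0) (c' a : ℝ) (g : PBond P n → ℝ) (x : Balaban1983to89.Site P n) :
    diverg c' (fun b => a * g b) x = a * (c' / c) * diverg c g x := by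
  simp only [diverg, smul_eq_mul, Finset.mul_sum]
  refine Finset.sum_congr rfl fun μ _ => ?_
  field_simp

/-- kernel: **`e^{ie′ηg} = e^{ieζ(ρg)}`**, `ρ = e′η/(eζ)` — a phase written in the units `(e, ζ)` of the `j`-th condition (`e, ζ ≠ 0`).
[cite: BalabanImbrieJaffe1988, (4.3) p.286] -/
theorem exp_units {e ζ : ℝ} (he : e ≠ 0) (hζ : ζ ≠ 0) (e' η g : ℝ) :
    exp (I * ((e' * η * g : ℝ) : ℂ)) = exp (I * ((e * ζ * (e' * η / (e * ζ) * g) : ℝ) : ℂ)) := by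
  congr 3
  field_simp

/-- kernel: `ζ⁻¹/η⁻¹ = η/ζ`. [cite: BalabanImbrieJaffe1988, (4.3) p.286] -/
theorem inv_div_inv_eq (ζ η : ℝ) : ζ⁻¹ / η⁻¹ = η / ζ := by
  rw [div_eq_mul_inv, inv_inv, mul_comm, div_eq_mul_inv]

/-! ## §2  «In an analogous fashion»: multiplying by a bounded phase keeps the `j`-th condition -/

/-- **The `j`-th regularity condition survives multiplication by the phase of a field bounded in η-units.**  If `u` satisfies (4.3) with
parameters `(e, ζ, c)` on a cube (r18's `Smooth43 e ζ c p r X B Pl u`) and `g` satisfies `|g| ≦ G₀` on `B`, `|∂^ηg| ≦ G₁` on `Pl`, `|∂^{η*}g| ≦ G₂`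
on `X`, then `u·exp(ie′ηg)` satisfies (4.3) with `(e, ζ, c + c′)` provided `|ρ|G₀ ≦ c′pr`, `|ρ(η/ζ)|G₁ ≦ c′pr`, `|ρ(η/ζ)|G₂ ≦ c′pr`,
`ρ = e′η/(eζ)` (same gauge function, potential `A^λ + ρg`; p36's `smooth43_mul_exp` in converted units).
[cite: BalabanImbrieJaffe1988, (4.3) p.286] -/
theorem smooth43_mul_exp_units {e ζ e' η c c' pej rej G₀ G₁ G₂ : ℝ} (he : e ≠ 0) (hζ : ζ ≠ 0) (hη : η ≠ 0)
    {X : Finset (Balaban1983to89.Site P n)} {B : Finset (PBond P n)} {Pl : Finset (Balaban1983to89.Plaq P n)} {u : PBond P n → ℂ}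
    {g : PBond P n → ℝ} (hu : Smooth43 e ζ c pej rej X B Pl u) (hg : ∀ b ∈ B, |g b| ≤ G₀)
    (hcurl : ∀ p ∈ Pl, |curl η⁻¹ g p| ≤ G₁) (hdiv : ∀ x ∈ X, |diverg η⁻¹ g x| ≤ G₂)
    (h₀ : |e' * η / (e * ζ)| * G₀ ≤ c' * pej * rej) (h₁ : |e' * η / (e * ζ) * (η / ζ)| * G₁ ≤ c' * pej * rej)
    (h₂ : |e' * η / (e * ζ) * (η / ζ)| * G₂ ≤ c' * pej * rej) :
    Smooth43 e ζ (c + c') pej rej X B Pl (fun b => u b * exp (I * ((e' * η * g b : ℝ) : ℂ))) := by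
  have hfun : (fun b => u b * exp (I * ((e' * η * g b : ℝ) : ℂ))) =
      fun b => u b * exp (I * ((e * ζ * ((fun b => e' * η / (e * ζ) * g b) b) : ℝ) : ℂ)) := by
    funext b; rw [exp_units he hζ]
  rw [hfun]
  have hηi : η⁻¹ ≠ 0 := inv_ne_zero hη
  refine smooth43_mul_exp hu (fun b hb => ?_) (fun p hp => ?_) (fun x hx => ?_)
  · rw [abs_mul]
    exact (mul_le_mul_of_nonneg_left (hg b hb) (abs_nonneg _)).trans h₀
  · rw [curl_units hηi, inv_div_inv_eq, abs_mul]
    exact (mul_le_mul_of_nonneg_left (hcurl p hp) (abs_nonneg _)).trans h₁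
  · rw [diverg_units hηi, inv_div_inv_eq, abs_mul]
    exact (mul_le_mul_of_nonneg_left (hdiv x hx) (abs_nonneg _)).trans h₂

/-- The same with the phase `exp(−ie′ηg)` (*"removing"* a field; potential `A^λ − ρg`). [cite: BalabanImbrieJaffe1988, (4.3) p.286] -/
theorem smooth43_mul_exp_neg_units {e ζ e' η c c' pej rej G₀ G₁ G₂ : ℝ} (he : e ≠ 0) (hζ : ζ ≠ 0) (hη : η ≠ 0)
    {X : Finset (Balaban1983to89.Site P n)} {B : Finset (PBond P n)} {Pl : Finset (Balaban1983to89.Plaq P n)} {u : PBond P n → ℂ}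
    {g : PBond P n → ℝ} (hu : Smooth43 e ζ c pej rej X B Pl u) (hg : ∀ b ∈ B, |g b| ≤ G₀)
    (hcurl : ∀ p ∈ Pl, |curl η⁻¹ g p| ≤ G₁) (hdiv : ∀ x ∈ X, |diverg η⁻¹ g x| ≤ G₂)
    (h₀ : |e' * η / (e * ζ)| * G₀ ≤ c' * pej * rej) (h₁ : |e' * η / (e * ζ) * (η / ζ)| * G₁ ≤ c' * pej * rej)
    (h₂ : |e' * η / (e * ζ) * (η / ζ)| * G₂ ≤ c' * pej * rej) :
    Smooth43 e ζ (c + c') pej rej X B Pl (fun b => u b * exp (-(I * ((e' * η * g b : ℝ) : ℂ)))) := by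
  have hfun : (fun b => u b * exp (-(I * ((e' * η * g b : ℝ) : ℂ)))) =
      fun b => u b * exp (I * ((e' * η * (fun b => -g b) b : ℝ) : ℂ)) := by
    funext b; congr 1; push_cast; ring_nf
  rw [hfun]
  refine smooth43_mul_exp_units he hζ hη hu (fun b hb => ?_) (fun p hp => ?_) (fun x hx => ?_) h₀ h₁ h₂
  · rw [abs_neg]; exact hg b hb
  · rw [show curl η⁻¹ (fun b => -g b) p = -curl η⁻¹ g p by
      have h := curl_units (inv_ne_zero hη) η⁻¹ (-1) g p
      rw [div_self (inv_ne_zero hη)] at h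
      simpa using h, abs_neg]
    exact hcurl p hp
  · rw [show diverg η⁻¹ (fun b => -g b) x = -diverg η⁻¹ g x by
      have h := diverg_units (inv_ne_zero hη) η⁻¹ (-1) g x
      rw [div_self (inv_ne_zero hη)] at h
      simpa using h, abs_neg]
    exact hdiv x hx

/-- Cube-family form (r16's `Regular286 cube G e ζ c p r`): the `j`-th condition on a family of cubes survives multiplication by `exp(ie′ηg)`
with `g` bounded in η-units on the bonds/plaquettes/sites of the cubes. [cite: BalabanImbrieJaffe1988, (4.3) p.286] -/
theorem regular286_mul_exp_units {γ : Type*} {cube : Balaban1983to89.Site P n → γ} {G : Set γ}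
    {e ζ e' η c c' pej rej G₀ G₁ G₂ : ℝ} (he : e ≠ 0) (hζ : ζ ≠ 0) (hη : η ≠ 0) {u : PBond P n → ℂ} {g : PBond P n → ℝ}
    (hu : Regular286 cube G e ζ c pej rej u) (hg : ∀ q ∈ G, ∀ b ∈ starB (cubeSites cube q), |g b| ≤ G₀)
    (hcurl : ∀ q ∈ G, ∀ p ∈ starP (cubeSites cube q), |curl η⁻¹ g p| ≤ G₁)
    (hdiv : ∀ q ∈ G, ∀ x ∈ cubeSites cube q, |diverg η⁻¹ g x| ≤ G₂)
    (h₀ : |e' * η / (e * ζ)| * G₀ ≤ c' * pej * rej) (h₁ : |e' * η / (e * ζ) * (η / ζ)| * G₁ ≤ c' * pej * rej)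
    (h₂ : |e' * η / (e * ζ) * (η / ζ)| * G₂ ≤ c' * pej * rej) :
    Regular286 cube G e ζ (c + c') pej rej (fun b => u b * exp (I * ((e' * η * g b : ℝ) : ℂ))) :=
  fun q hq => smooth43_mul_exp_units he hζ hη (hu q hq) (hg q hq) (hcurl q hq) (hdiv q hq) h₀ h₁ h₂

/-- Cube-family form with `exp(−ie′ηg)`. [cite: BalabanImbrieJaffe1988, (4.3) p.286] -/
theorem regular286_mul_exp_neg_units {γ : Type*} {cube : Balaban1983to89.Site P n → γ} {G : Set γ}
    {e ζ e' η c c' pej rej G₀ G₁ G₂ : ℝ} (he : e ≠ 0) (hζ : ζ ≠ 0) (hη : η ≠ 0) {u : PBond P n → ℂ} {g : PBond P n → ℝ}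
    (hu : Regular286 cube G e ζ c pej rej u) (hg : ∀ q ∈ G, ∀ b ∈ starB (cubeSites cube q), |g b| ≤ G₀)
    (hcurl : ∀ q ∈ G, ∀ p ∈ starP (cubeSites cube q), |curl η⁻¹ g p| ≤ G₁)
    (hdiv : ∀ q ∈ G, ∀ x ∈ cubeSites cube q, |diverg η⁻¹ g x| ≤ G₂)
    (h₀ : |e' * η / (e * ζ)| * G₀ ≤ c' * pej * rej) (h₁ : |e' * η / (e * ζ) * (η / ζ)| * G₁ ≤ c' * pej * rej)
    (h₂ : |e' * η / (e * ζ) * (η / ζ)| * G₂ ≤ c' * pej * rej) :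
    Regular286 cube G e ζ (c + c') pej rej (fun b => u b * exp (-(I * ((e' * η * g b : ℝ) : ℂ)))) :=
  fun q hq => smooth43_mul_exp_neg_units he hζ hη (hu q hq) (hg q hq) (hcurl q hq) (hdiv q hq) h₀ h₁ h₂

/-! ## §3  The `j`-th condition for `ũ_{k+1}`: «remains valid» -/

/-- **«the j-th regularity condition … remains valid» for `ũ_{k+1}` of (5.6.1).**  With the `j`-th data `(e_j, ζ)` (`e_j, ζ ≠ 0`), a cube family
`G` (in print the `r(e_k)`-cubes, labelled by `cube`), the (5.5.14) field `u′_k = (Q^{s*}_{k+1}v) exp ie_kη[H_{k,loc}A^{(k)} − L⁻²DXf + w₁A′]`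
(r16's `bgExp`, abstract `Q`) satisfying the `j`-th condition with constant `c`, and the removed field `g = θ_kH_{k,loc}A^{(k)} + w₁A′` bounded IN
η-UNITS on the cubes (`|g| ≦ G₀`, `|∂^ηg| ≦ G₁`, `|∂^{η*}g| ≦ G₂`), the new field `ũ_{k+1} = u′_k·exp(−ie_kηg)` (r16's `uTilde561`; (5.6.6)
inverted, gen-8 `uTilde561_eq_mul_exp_neg`) satisfies the `j`-th condition with constant `c + c′` once `|ρ|G₀, |ρ(η/ζ)|G₁, |ρ(η/ζ)|G₂ ≦
c′p(e_j)r(e_j)`, `ρ = e_kη/(e_jζ)`. [cite: BalabanImbrieJaffe1988, (4.3) p.286] -/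
theorem regular286J_uTilde561 {γ : Type*} {cube : Balaban1983to89.Site P n → γ} {G : Set γ}
    {ej ζ ek η c c' pej rej G₀ G₁ G₂ : ℝ} (hej : ej ≠ 0) (hζ : ζ ≠ 0) (hη : η ≠ 0) (L : ℝ) {Q : PBond P n → ℂ}
    {θ HA DXf wA : PBond P n → ℝ}
    (h : Regular286 cube G ej ζ c pej rej (bgExp ek η Q (fun b => HA b - L⁻¹ ^ 2 * DXf b + wA b)))
    (hg : ∀ q ∈ G, ∀ b ∈ starB (cubeSites cube q), |θ b * HA b + wA b| ≤ G₀)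
    (hcurl : ∀ q ∈ G, ∀ p ∈ starP (cubeSites cube q), |curl η⁻¹ (fun b => θ b * HA b + wA b) p| ≤ G₁)
    (hdiv : ∀ q ∈ G, ∀ x ∈ cubeSites cube q, |diverg η⁻¹ (fun b => θ b * HA b + wA b) x| ≤ G₂)
    (h₀ : |ek * η / (ej * ζ)| * G₀ ≤ c' * pej * rej) (h₁ : |ek * η / (ej * ζ) * (η / ζ)| * G₁ ≤ c' * pej * rej)
    (h₂ : |ek * η / (ej * ζ) * (η / ζ)| * G₂ ≤ c' * pej * rej) :
    Regular286 cube G ej ζ (c + c') pej rej (uTilde561 ek η L Q θ HA DXf) := by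
  have hfun : uTilde561 ek η L Q θ HA DXf = fun b =>
      bgExp ek η Q (fun b => HA b - L⁻¹ ^ 2 * DXf b + wA b) b * exp (-(I * ((ek * η * (θ b * HA b + wA b) : ℝ) : ℂ))) :=
    funext fun b => uTilde561_eq_mul_exp_neg ek η L Q θ HA DXf wA b
  rw [hfun]
  exact regular286_mul_exp_neg_units (g := fun b => θ b * HA b + wA b) hej hζ hη h hg hcurl hdiv h₀ h₁ h₂

/-- **The `j`-th condition for `ũ_{k+1}` with the three η-unit bounds DERIVED** (gen-9 `BIJ88RemovedFieldBounds286.removedField_bounds`: discrete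
Leibniz for `θ_k` with `|θ_k| ≦ 1` and Lipschitz constant `ℓ`, field-level bounds `G_i` on `H_{k,loc}A^{(k)}` and `V_i` on `w₁A′`): the `j`-th condition
of `u′_k` with constant `c` and the side conditions `|ρ|(G₀ + V₀) ≦ c′pr`, `|ρ(η/ζ)|(G₁ + 2|η⁻¹|ℓG₀ + V₁) ≦ c′pr`, `|ρ(η/ζ)|(G₂ + d|η⁻¹|ℓG₀ + V₂) ≦ c′pr`,
`ρ = e_kη/(e_jζ)` ⟹ the `j`-th condition of `ũ_{k+1}` with constant `c + c′`. [cite: BalabanImbrieJaffe1988, (4.3) p.286] -/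
theorem regular286J_uTilde561_of_fieldBounds {γ : Type*} {cube : Balaban1983to89.Site P n → γ} {G : Set γ}
    {ej ζ ek η c c' pej rej ℓ G₀ G₁ G₂ V₀ V₁ V₂ : ℝ} (hej : ej ≠ 0) (hζ : ζ ≠ 0) (hη : η ≠ 0) (L : ℝ) {Q : PBond P n → ℂ}
    {θ HA DXf wA : PBond P n → ℝ}
    (h : Regular286 cube G ej ζ c pej rej (bgExp ek η Q (fun b => HA b - L⁻¹ ^ 2 * DXf b + wA b)))
    (hθ : ∀ b, |θ b| ≤ 1) (hLip : ∀ b b' : PBond P n, |θ b - θ b'| ≤ ℓ * (supDist b.src b'.src : ℝ)) (hℓ : 0 ≤ ℓ)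
    (hHA : ∀ b, |HA b| ≤ G₀) (hHA₁ : ∀ p, |curl η⁻¹ HA p| ≤ G₁) (hHA₂ : ∀ x, |diverg η⁻¹ HA x| ≤ G₂)
    (hwA : ∀ b, |wA b| ≤ V₀) (hwA₁ : ∀ p, |curl η⁻¹ wA p| ≤ V₁) (hwA₂ : ∀ x, |diverg η⁻¹ wA x| ≤ V₂)
    (h₀ : |ek * η / (ej * ζ)| * (G₀ + V₀) ≤ c' * pej * rej)
    (h₁ : |ek * η / (ej * ζ) * (η / ζ)| * (G₁ + 2 * |η⁻¹| * ℓ * G₀ + V₁) ≤ c' * pej * rej)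
    (h₂ : |ek * η / (ej * ζ) * (η / ζ)| * (G₂ + P.d * |η⁻¹| * ℓ * G₀ + V₂) ≤ c' * pej * rej) :
    Regular286 cube G ej ζ (c + c') pej rej (uTilde561 ek η L Q θ HA DXf) := by
  obtain ⟨hb, hp, hx⟩ := removedField_bounds (η := η) hθ hLip hℓ hHA hHA₁ hHA₂ hwA hwA₁ hwA₂
  exact regular286J_uTilde561 hej hζ hη L h (fun _ _ b _ => hb b) (fun _ _ p _ => hp p) (fun _ _ x _ => hx x) h₀ h₁ h₂

end

end Literature.MathematicalPhysics.QuantumFieldTheory.BalabanImbrieJaffe1984to88.BIJ88RegularityJ286
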